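import Literature.NumberTheory.Automorphic.UnitaryGroupOfLocalTorusMeasure
import Literature.NumberTheory.Automorphic.UnitaryGroupLocalTorusPackage
import Literature.NumberTheory.Automorphic.UnitaryGroupOrbitalMeasureFamilyOfLocal
import Literature.NumberTheory.Automorphic.UnitaryGroupArchUnimodular
import HarnessLib

/-!
# `U(H)`'s adelic orbital measure `ofLocal` at a regular class IS `dg ∕ dt` for the KIT's Haar measure: the tower instantiated
(Rogawski (1990) §4.3 pp. 43–44, §5.4 p. 72; Gelbart (1975) p. 155 (10.19))

Topic `NumberTheory/Automorphic`; namespace `Literature.NumberTheory.Automorphic.UnitaryGroup`; THEOREMS ONLY (no definition, no named fact, no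
`sorry`, no instance, no notation).  Sequel of ★ `UnitaryGroupOfLocalTorusMeasure` (the tower of torus measures with its Haar packages) and ★
`UnitaryGroupLocalTorusPackage` (the model-side local data of a CANONICAL local family): for a local orbital-measure family `mG v` canonical on the
regular classes for local Haar measures `ν_v` normalised by `ν_v(U(H)(𝒪_v)) = 1`, an archimedean family `mGi` reading `ν_∞ ∕ t_∞` at the class for every
archimedean Haar measure `ν_∞` (the arch coherence of the kit, consumed as a hypothesis), and ANY Haar measure `ν_𝔸` on `U(H)(𝔸_{L⁺})`, the family ★
`AdelicOrbitalMeasureFamily.ofLocal L N H mG mGi` at a REGULAR rational class `c` is the quotient measure `dν_𝔸 ∕ dt_𝔸` for the product torus measure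
`t_𝔸` of the tower — with every intermediate measure, its Haar package and its equation exported (for the stable-conjugacy coherence step).

* **`UnitaryGroup.exists_tower_ofLocal_eq_quotientMeasure`** — the (O10-c4-a) per-class kit instantiation.

Provenance (cell `pub/hodgecm-mathlib`, row (O10-c4-a)): statement and proof by F0P3a-p06 (g4); compile fixes by
F0P4-p03 (g4); v2 (the exported `ht1` conjunct, consumed by the (c4-b) head) and filing by A-p12 (g14).

## References
* J. D. Rogawski, *Automorphic Representations of Unitary Groups in Three Variables* (1990), §4.3 pp. 43–44, §5.4 p. 72 [Rogawski1990].
* S. Gelbart, *Automorphic forms on adele groups* (1975), p. 155 (10.19) [Gelbart1975].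
* A. Deitmar, S. Echterhoff, *Principles of Harmonic Analysis* (2nd ed. 2014), Thm. 1.5.3 [DeitmarEchterhoff2014].
-/

set_option autoImplicit false

noncomputable section

open _root_.MeasureTheory _root_.MeasureTheory.Measure Set Filter Function NumberField IsDedekindDomain
open _root_.Topology
open Literature.Topology.RestrictedProduct Literature.Topology.Algebra.RestrictedProduct Literature.MeasureTheory.Group
open Literature.MeasureTheory.RestrictedProduct Literature.NumberTheory.Rogawski1990
open scoped RestrictedProduct ENNReal NNReal Pointwise Matrix

namespace Literature.NumberTheory.Automorphic

namespace UnitaryGroup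

section Kit

variable (L : Type) [Field L] [NumberField L] [IsCMField L] (N : ℕ) (H : Matrix (Fin N) (Fin N) L)
  [∀ g : (cmDatum L N H).Adelic, MeasurableSpace ((cmDatum L N H).Adelic ⧸ Subgroup.centralizer ({g} : Set (cmDatum L N H).Adelic))]
  [∀ g : (cmDatum L N H).Adelic, BorelSpace ((cmDatum L N H).Adelic ⧸ Subgroup.centralizer ({g} : Set (cmDatum L N H).Adelic))]
  [∀ a : (arch (↥(maximalRealSubfield L)) L (IsCMField.complexConj L) N H), MeasurableSpace ((arch (↥(maximalRealSubfield L)) L (IsCMField.complexConj L) N H) ⧸ Subgroup.centralizer ({a} : Set (arch (↥(maximalRealSubfield L)) L (IsCMField.complexConj L) N H)))]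
  [∀ a : (arch (↥(maximalRealSubfield L)) L (IsCMField.complexConj L) N H), BorelSpace ((arch (↥(maximalRealSubfield L)) L (IsCMField.complexConj L) N H) ⧸ Subgroup.centralizer ({a} : Set (arch (↥(maximalRealSubfield L)) L (IsCMField.complexConj L) N H)))]
  [∀ (v : HeightOneSpectrum (𝓞 ↥(maximalRealSubfield L))) (x : (cmDatum L N H).Local v),
    MeasurableSpace ((cmDatum L N H).Local v ⧸ Subgroup.centralizer ({x} : Set ((cmDatum L N H).Local v)))]
  [∀ (v : HeightOneSpectrum (𝓞 ↥(maximalRealSubfield L))) (x : (cmDatum L N H).Local v),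
    BorelSpace ((cmDatum L N H).Local v ⧸ Subgroup.centralizer ({x} : Set ((cmDatum L N H).Local v)))]
  [∀ v, MeasurableSpace ((cmDatum L N H).Local v)] [∀ v, BorelSpace ((cmDatum L N H).Local v)]
  [∀ v, MeasurableSpace (↥(localPi L (IsCMField.complexConj L) N H v))] [∀ v, BorelSpace (↥(localPi L (IsCMField.complexConj L) N H v))]
  [MeasurableSpace (finAdelic (↥(maximalRealSubfield L)) L (IsCMField.complexConj L) N H)] [BorelSpace (finAdelic (↥(maximalRealSubfield L)) L (IsCMField.complexConj L) N H)]
  [MeasurableSpace (cmDatum L N H).Adelic] [BorelSpace (cmDatum L N H).Adelic]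
  [MeasurableSpace (arch (↥(maximalRealSubfield L)) L (IsCMField.complexConj L) N H)] [BorelSpace (arch (↥(maximalRealSubfield L)) L (IsCMField.complexConj L) N H)]
  (mG : ∀ v : HeightOneSpectrum (𝓞 ↥(maximalRealSubfield L)), OrbitalMeasureFamily ((cmDatum L N H).Local v))
  (mGi : OrbitalMeasureFamily (arch (↥(maximalRealSubfield L)) L (IsCMField.complexConj L) N H))
  (c : ConjClasses (cmDatum L N H).Rational)

set_option maxHeartbeats 16000000 in
set_option synthInstance.maxHeartbeats 800000 in
-- HB: statement elaboration on the concrete `cmDatum` ∕ restricted-product carriers, as for ★ `exists_tower_adelicOrbitalMeasureOfLocal_eq_quotientMeasure`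
/-- **`ofLocal` at a regular class IS `dν_𝔸 ∕ dt_𝔸`, tower exported** (O10-c4-a).  `H` hermitian non-degenerate anisotropic; `ν_v` Haar, right
invariant, `ν_v(U(H)(𝒪_v)) = 1`; `mG v` canonical on the regular classes for `ν_v` (pin (xi‴)); `mGi` reads `ν_∞ ∕ t_∞` at `γ_∞` for every
archimedean Haar `ν_∞` (`harch`, pin (xii) read through ★ (AQ)); `ν_𝔸` any Haar measure on `U(H)(𝔸)`; `c` a regular rational class, `g = γ ⊗ 1`,
`γ = out c`.  THEN there are: a finite set `S₀` of places, local torus measures `t_v` (Haar, inversion invariant, compact-core mass one, `(mG v).atPoint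
g_v = ν_v ∕ t_v`), an archimedean Haar measure `ν_∞` with `ν_𝔸 = e_* (ν_∞ ⊗ ν_f)` (★ C-glob) and its torus measure `t_∞`, and the tower `ν_rp, ρ, ρ_M, ν_f,
t_f, t_P, t_𝔸` of ★ `exists_tower_adelicOrbitalMeasureOfLocal_eq_quotientMeasure` for the model data `t′_v = (ψ_v⁻¹|)_* t_v`, `ν′_v = (ψ_v⁻¹)_* ν_v` of ★
`UnitaryGroupLocalTorusPackage` (all Haar, with their equations), such that the local family is normalised at `g` off `S₀`, the model torus measures `t′_v` give mass one to the compact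
cores `inH v` off `S₀` (the `ht1` letter of ★ (δ4-CM)), and
`AdelicOrbitalMeasureFamily.ofLocal L N H mG mGi c = quotientMeasure U(H)(𝔸)_g t_𝔸 ν_𝔸`. [cite: Rogawski1990, §5.4 p. 72] [cite: Gelbart1975, p. 155 (10.19)] -/
theorem exists_tower_ofLocal_eq_quotientMeasure
    (hanis : ∀ x : Fin N → L, hermForm (cmConjRingHom L) H x x = 0 → x = 0)
    (hH : (H.map (cmConjRingHom L))ᵀ = H) (hHd : H.det ≠ 0)
    (ν : ∀ v, Measure ((cmDatum L N H).Local v)) [∀ v, IsHaarMeasure (ν v)] [∀ v, (ν v).IsMulRightInvariant]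
    (hK : ∀ v, ν v (cmLocalIntegralLevel L N H v : Set ((cmDatum L N H).Local v)) = 1)
    (hcan : ∀ v, (mG v).IsCanonical (fun x => IsRegularElt (x.val : GL (Fin N) (LocalRing L v))) (ν v))
    (hreg : IsRegularElt ((Quotient.out c).val : GL (Fin N) L))
    (νA : Measure (cmDatum L N H).Adelic) [IsHaarMeasure νA]
    (harch : ∀ (νi : Measure (arch (↥(maximalRealSubfield L)) L (IsCMField.complexConj L) N H)) [IsHaarMeasure νi] [νi.IsMulRightInvariant],
      ∃ ti : Measure (Subgroup.centralizer ({archPart (↥(maximalRealSubfield L)) L (IsCMField.complexConj L) N H ((cmDatum L N H).toAdelic (Quotient.out c))} : Set (arch (↥(maximalRealSubfield L)) L (IsCMField.complexConj L) N H))), ∃ (_ : IsHaarMeasure ti) (_ : ti.IsInvInvariant),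
        mGi.atPoint (archPart (↥(maximalRealSubfield L)) L (IsCMField.complexConj L) N H ((cmDatum L N H).toAdelic (Quotient.out c))) = quotientMeasure (Subgroup.centralizer ({archPart (↥(maximalRealSubfield L)) L (IsCMField.complexConj L) N H ((cmDatum L N H).toAdelic (Quotient.out c))} : Set (arch (↥(maximalRealSubfield L)) L (IsCMField.complexConj L) N H))) ti (isClosed_coe_centralizer_singleton _) νi)
    (ψ : ∀ v, ↥(localPi L (IsCMField.complexConj L) N H v) ≃ₜ* (cmDatum L N H).Local v) (hψ : ψ = fun v => localPiEquiv L (IsCMField.complexConj L) N H v)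
    (hCrp : ∀ x : (Πʳ v : HeightOneSpectrum (𝓞 ↥(maximalRealSubfield L)), [↥(localPi L (IsCMField.complexConj L) N H v), localInt L (IsCMField.complexConj L) N H v]), (finAdelicEquiv (↥(maximalRealSubfield L)) L (IsCMField.complexConj L) N H).symm.toMulEquiv x ∈ (Subgroup.centralizer ({(finPart (↥(maximalRealSubfield L)) L (IsCMField.complexConj L) N H ((cmDatum L N H).toAdelic (Quotient.out c)))} : Set (finAdelic (↥(maximalRealSubfield L)) L (IsCMField.complexConj L) N H))) ↔ x ∈ (Subgroup.centralizer ({(finAdelicEquiv (↥(maximalRealSubfield L)) L (IsCMField.complexConj L) N H) (finPart (↥(maximalRealSubfield L)) L (IsCMField.complexConj L) N H ((cmDatum L N H).toAdelic (Quotient.out c)))} : Set (Πʳ v : HeightOneSpectrum (𝓞 ↥(maximalRealSubfield L)), [↥(localPi L (IsCMField.complexConj L) N H v), localInt L (IsCMField.complexConj L) N H v]))))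
    (e : (arch (↥(maximalRealSubfield L)) L (IsCMField.complexConj L) N H) × (finAdelic (↥(maximalRealSubfield L)) L (IsCMField.complexConj L) N H) ≃* (cmDatum L N H).Adelic)
    (he' : e = (adelicProdEquiv (↥(maximalRealSubfield L)) L (IsCMField.complexConj L) N H).symm.toMulEquiv) (he : Continuous e) (hes : Continuous e.symm)
    (hg : e (archPart (↥(maximalRealSubfield L)) L (IsCMField.complexConj L) N H ((cmDatum L N H).toAdelic (Quotient.out c)), finPart (↥(maximalRealSubfield L)) L (IsCMField.complexConj L) N H ((cmDatum L N H).toAdelic (Quotient.out c))) = ((cmDatum L N H).toAdelic (Quotient.out c))) :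
    ∃ (S₀ : Finset (HeightOneSpectrum (𝓞 ↥(maximalRealSubfield L)))) (t : ∀ v, Measure (Subgroup.centralizer ({((cmDatum L N H).toLocal v ((cmDatum L N H).toAdelic (Quotient.out c)))} : Set ((cmDatum L N H).Local v))))
      (νi : Measure (arch (↥(maximalRealSubfield L)) L (IsCMField.complexConj L) N H)) (ti : Measure (Subgroup.centralizer ({archPart (↥(maximalRealSubfield L)) L (IsCMField.complexConj L) N H ((cmDatum L N H).toAdelic (Quotient.out c))} : Set (arch (↥(maximalRealSubfield L)) L (IsCMField.complexConj L) N H))))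
      (νrp : Measure (Πʳ v : HeightOneSpectrum (𝓞 ↥(maximalRealSubfield L)), [↥(localPi L (IsCMField.complexConj L) N H v), localInt L (IsCMField.complexConj L) N H v])) (ρ : Measure (cutout (fun v => localInt L (IsCMField.complexConj L) N H v) (fun v => (Subgroup.centralizer ({(finAdelicEquiv (↥(maximalRealSubfield L)) L (IsCMField.complexConj L) N H) (finPart (↥(maximalRealSubfield L)) L (IsCMField.complexConj L) N H ((cmDatum L N H).toAdelic (Quotient.out c))) v} : Set ↥(localPi L (IsCMField.complexConj L) N H v)))))) (ρM : Measure (Subgroup.centralizer ({(finAdelicEquiv (↥(maximalRealSubfield L)) L (IsCMField.complexConj L) N H) (finPart (↥(maximalRealSubfield L)) L (IsCMField.complexConj L) N H ((cmDatum L N H).toAdelic (Quotient.out c)))} : Set (Πʳ v : HeightOneSpectrum (𝓞 ↥(maximalRealSubfield L)), [↥(localPi L (IsCMField.complexConj L) N H v), localInt L (IsCMField.complexConj L) N H v])))) (νf : Measure (finAdelic (↥(maximalRealSubfield L)) L (IsCMField.complexConj L) N H)) (tf : Measure (Subgroup.centralizer ({(finPart (↥(maximalRealSubfield L)) L (IsCMField.complexConj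 L) N H ((cmDatum L N H).toAdelic (Quotient.out c)))} : Set (finAdelic (↥(maximalRealSubfield L)) L (IsCMField.complexConj L) N H))))
      (tP : Measure ((Subgroup.centralizer ({archPart (↥(maximalRealSubfield L)) L (IsCMField.complexConj L) N H ((cmDatum L N H).toAdelic (Quotient.out c))} : Set (arch (↥(maximalRealSubfield L)) L (IsCMField.complexConj L) N H))).prod (Subgroup.centralizer ({(finPart (↥(maximalRealSubfield L)) L (IsCMField.complexConj L) N H ((cmDatum L N H).toAdelic (Quotient.out c)))} : Set (finAdelic (↥(maximalRealSubfield L)) L (IsCMField.complexConj L) N H))))) (tA : Measure (Subgroup.centralizer ({((cmDatum L N H).toAdelic (Quotient.out c))} : Set (cmDatum L N H).Adelic))),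
      ∃ (_ : ∀ v, IsHaarMeasure (t v)) (_ : ∀ v, (t v).IsInvInvariant) (_ : IsHaarMeasure νi) (_ : νi.IsMulRightInvariant)
        (_ : IsHaarMeasure ti) (_ : ti.IsInvInvariant)
        (_ : IsHaarMeasure νrp) (_ : νrp.IsMulRightInvariant) (_ : IsHaarMeasure ρ) (_ : ρ.IsInvInvariant) (_ : SFinite ρ)
        (_ : IsHaarMeasure ρM) (_ : ρM.IsInvInvariant) (_ : SFinite ρM) (_ : IsHaarMeasure νf) (_ : νf.IsMulRightInvariant)
        (_ : IsHaarMeasure tf) (_ : tf.IsInvInvariant) (_ : SFinite tf) (_ : IsHaarMeasure tP) (_ : tP.IsInvInvariant) (_ : SFinite tP)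
        (_ : IsHaarMeasure tA) (_ : tA.IsMulRightInvariant) (_ : tA.IsInvInvariant) (_ : SFinite tA) (_ : νA.IsMulRightInvariant),
      (∀ v, t v (compactCore (Subgroup.centralizer ({((cmDatum L N H).toLocal v ((cmDatum L N H).toAdelic (Quotient.out c)))} : Set ((cmDatum L N H).Local v)))) = 1) ∧
      (∀ v, (mG v).atPoint ((cmDatum L N H).toLocal v ((cmDatum L N H).toAdelic (Quotient.out c))) = quotientMeasure (Subgroup.centralizer ({((cmDatum L N H).toLocal v ((cmDatum L N H).toAdelic (Quotient.out c)))} : Set ((cmDatum L N H).Local v))) (t v) (isClosed_coe_centralizer_singleton _) (ν v)) ∧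
      mGi.atPoint (archPart (↥(maximalRealSubfield L)) L (IsCMField.complexConj L) N H ((cmDatum L N H).toAdelic (Quotient.out c))) = quotientMeasure (Subgroup.centralizer ({archPart (↥(maximalRealSubfield L)) L (IsCMField.complexConj L) N H ((cmDatum L N H).toAdelic (Quotient.out c))} : Set (arch (↥(maximalRealSubfield L)) L (IsCMField.complexConj L) N H))) ti (isClosed_coe_centralizer_singleton _) νi ∧
      IsNormalisedOff L N H mG ((cmDatum L N H).toAdelic (Quotient.out c)) S₀ ∧
      (∀ v, v ∉ S₀ → (Measure.map (subgroupCongrHomeomorph (ψ v).symm.toMulEquiv (Subgroup.centralizer ({((cmDatum L N H).toLocal v ((cmDatum L N H).toAdelic (Quotient.out c)))} : Set ((cmDatum L N H).Local v))) (Subgroup.centralizer ({(finAdelicEquiv (↥(maximalRealSubfield L)) L (IsCMField.complexConj L) N H) (finPart (↥(maximalRealSubfield L)) L (IsCMField.complexConj L) N H ((cmDatum L N H).toAdelic (Quotient.out c))) v} : Set ↥(localPi L (IsCMField.complexConj L) N H v))) (localPiEquiv_symm_mem_centralizer_iff L N H v ((cmDatum L N H).toAdelic (Quotient.out c)) (ψ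 v) (congrFun hψ v)) (ψ v).symm.continuous (ψ v).continuous) (t v)) ((((inH (fun v => localInt L (IsCMField.complexConj L) N H v) (fun v => (Subgroup.centralizer ({(finAdelicEquiv (↥(maximalRealSubfield L)) L (IsCMField.complexConj L) N H) (finPart (↥(maximalRealSubfield L)) L (IsCMField.complexConj L) N H ((cmDatum L N H).toAdelic (Quotient.out c))) v} : Set ↥(localPi L (IsCMField.complexConj L) N H v)))) v) : Subgroup (Subgroup.centralizer ({(finAdelicEquiv (↥(maximalRealSubfield L)) L (IsCMField.complexConj L) N H) (finPart (↥(maximalRealSubfield L)) L (IsCMField.complexConj L) N H ((cmDatum L N H).toAdelic (Quotient.out c))) v} : Set ↥(localPi L (IsCMField.complexConj L) N H v)))) : Set (Subgroup.centralizer ({(finAdelicEquiv (↥(maximalRealSubfield L)) L (IsCMField.complexConj L) N H) (finPart (↥(maximalRealSubfield L)) L (IsCMField.complexConj L) N H ((cmDatum L N H).toAdelic (Quotient.out c))) v} : Set ↥(localPi L (IsCMField.complexConj L) N H v))))) = 1) ∧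
      νrp = rpMeasure (fun v => (localInt L (IsCMField.complexConj L) N H v : Set ↥(localPi L (IsCMField.complexConj L) N H v))) (fun v => (Measure.map (ψ v).symm (ν v))) S₀ ∧
      ρ = Measure.map (cutoutEquiv (fun v => localInt L (IsCMField.complexConj L) N H v) (fun v => (Subgroup.centralizer ({(finAdelicEquiv (↥(maximalRealSubfield L)) L (IsCMField.complexConj L) N H) (finPart (↥(maximalRealSubfield L)) L (IsCMField.complexConj L) N H ((cmDatum L N H).toAdelic (Quotient.out c))) v} : Set ↥(localPi L (IsCMField.complexConj L) N H v)))))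
        (rpMeasure (fun v => (((inH (fun v => localInt L (IsCMField.complexConj L) N H v) (fun v => (Subgroup.centralizer ({(finAdelicEquiv (↥(maximalRealSubfield L)) L (IsCMField.complexConj L) N H) (finPart (↥(maximalRealSubfield L)) L (IsCMField.complexConj L) N H ((cmDatum L N H).toAdelic (Quotient.out c))) v} : Set ↥(localPi L (IsCMField.complexConj L) N H v)))) v) : Subgroup (Subgroup.centralizer ({(finAdelicEquiv (↥(maximalRealSubfield L)) L (IsCMField.complexConj L) N H) (finPart (↥(maximalRealSubfield L)) L (IsCMField.complexConj L) N H ((cmDatum L N H).toAdelic (Quotient.out c))) v} : Set ↥(localPi L (IsCMField.complexConj L) N H v)))) : Set (Subgroup.centralizer ({(finAdelicEquiv (↥(maximalRealSubfield L)) L (IsCMField.complexConj L) N H) (finPart (↥(maximalRealSubfield L)) L (IsCMField.complexConj L) N H ((cmDatum L N H).toAdelic (Quotient.out c))) v} : Set ↥(localPi L (IsCMField.complexConj L) N H v))))) (fun v => (Measure.map (subgroupCongrHomeomorph (ψ v).symm.toMulEquiv (Subgroup.centralizer ({((cmDatum L N H).toLocal v ((cmDatum L N H).toAdelic (Quotient.out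 c)))} : Set ((cmDatum L N H).Local v))) (Subgroup.centralizer ({(finAdelicEquiv (↥(maximalRealSubfield L)) L (IsCMField.complexConj L) N H) (finPart (↥(maximalRealSubfield L)) L (IsCMField.complexConj L) N H ((cmDatum L N H).toAdelic (Quotient.out c))) v} : Set ↥(localPi L (IsCMField.complexConj L) N H v))) (localPiEquiv_symm_mem_centralizer_iff L N H v ((cmDatum L N H).toAdelic (Quotient.out c)) (ψ v) (congrFun hψ v)) (ψ v).symm.continuous (ψ v).continuous) (t v))) S₀) ∧
      ρM = Measure.map (subgroupCongrHomeomorph (MulEquiv.refl (Πʳ v : HeightOneSpectrum (𝓞 ↥(maximalRealSubfield L)), [↥(localPi L (IsCMField.complexConj L) N H v), localInt L (IsCMField.complexConj L) N H v])) (cutout (fun v => localInt L (IsCMField.complexConj L) N H v) (fun v => (Subgroup.centralizer ({(finAdelicEquiv (↥(maximalRealSubfield L)) L (IsCMField.complexConj L) N H) (finPart (↥(maximalRealSubfield L)) L (IsCMField.complexConj L) N H ((cmDatum L N H).toAdelic (Quotient.out c))) v} : Set ↥(localPi L (IsCMField.complexConj L) N H v))))) (Subgroup.centralizer ({(finAdelicEquiv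 (↥(maximalRealSubfield L)) L (IsCMField.complexConj L) N H) (finPart (↥(maximalRealSubfield L)) L (IsCMField.complexConj L) N H ((cmDatum L N H).toAdelic (Quotient.out c)))} : Set (Πʳ v : HeightOneSpectrum (𝓞 ↥(maximalRealSubfield L)), [↥(localPi L (IsCMField.complexConj L) N H v), localInt L (IsCMField.complexConj L) N H v]))) (forall_refl_mem_iff (fun v => localInt L (IsCMField.complexConj L) N H v) (fun v => (Subgroup.centralizer ({(finAdelicEquiv (↥(maximalRealSubfield L)) L (IsCMField.complexConj L) N H) (finPart (↥(maximalRealSubfield L)) L (IsCMField.complexConj L) N H ((cmDatum L N H).toAdelic (Quotient.out c))) v} : Set ↥(localPi L (IsCMField.complexConj L) N H v)))) _ (mem_centralizer_singleton_iff_forall_mem (fun v => localInt L (IsCMField.complexConj L) N H v) ((finAdelicEquiv (↥(maximalRealSubfield L)) L (IsCMField.complexConj L) N H) (finPart (↥(maximalRealSubfield L)) L (IsCMField.complexConj L) N H ((cmDatum L N H).toAdelic (Quotient.out c)))))) continuous_id continuous_id) ρ ∧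
      νf = Measure.map (finAdelicEquiv (↥(maximalRealSubfield L)) L (IsCMField.complexConj L) N H).symm.toMulEquiv νrp ∧
      tf = Measure.map (subgroupCongrHomeomorph (finAdelicEquiv (↥(maximalRealSubfield L)) L (IsCMField.complexConj L) N H).symm.toMulEquiv (Subgroup.centralizer ({(finAdelicEquiv (↥(maximalRealSubfield L)) L (IsCMField.complexConj L) N H) (finPart (↥(maximalRealSubfield L)) L (IsCMField.complexConj L) N H ((cmDatum L N H).toAdelic (Quotient.out c)))} : Set (Πʳ v : HeightOneSpectrum (𝓞 ↥(maximalRealSubfield L)), [↥(localPi L (IsCMField.complexConj L) N H v), localInt L (IsCMField.complexConj L) N H v]))) (Subgroup.centralizer ({(finPart (↥(maximalRealSubfield L)) L (IsCMField.complexConj L) N H ((cmDatum L N H).toAdelic (Quotient.out c)))} : Set (finAdelic (↥(maximalRealSubfield L)) L (IsCMField.complexConj L) N H))) hCrp (finAdelicEquiv (↥(maximalRealSubfield L)) L (IsCMField.complexConj L) N H).symm.continuous (finAdelicEquiv (↥(maximalRealSubfield L)) L (IsCMField.complexConj L) N H).continuous) ρM ∧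
      Measure.map (Subgroup.prodEquiv (Subgroup.centralizer ({archPart (↥(maximalRealSubfield L)) L (IsCMField.complexConj L) N H ((cmDatum L N H).toAdelic (Quotient.out c))} : Set (arch (↥(maximalRealSubfield L)) L (IsCMField.complexConj L) N H))) (Subgroup.centralizer ({(finPart (↥(maximalRealSubfield L)) L (IsCMField.complexConj L) N H ((cmDatum L N H).toAdelic (Quotient.out c)))} : Set (finAdelic (↥(maximalRealSubfield L)) L (IsCMField.complexConj L) N H)))) tP = ti.prod tf ∧
      tA = Measure.map (subgroupCongrHomeomorph e ((Subgroup.centralizer ({archPart (↥(maximalRealSubfield L)) L (IsCMField.complexConj L) N H ((cmDatum L N H).toAdelic (Quotient.out c))} : Set (arch (↥(maximalRealSubfield L)) L (IsCMField.complexConj L) N H))).prod (Subgroup.centralizer ({(finPart (↥(maximalRealSubfield L)) L (IsCMField.complexConj L) N H ((cmDatum L N H).toAdelic (Quotient.out c)))} : Set (finAdelic (↥(maximalRealSubfield L)) L (IsCMField.complexConj L) N H)))) (Subgroup.centralizer ({((cmDatum L N H).toAdelic (Quotient.out c))} : Set (cmDatum L N H).Adelic)) (forall_apply_mem_centralizer_iff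 e hg) he hes) tP ∧
      νA = Measure.map e (νi.prod νf) ∧
      AdelicOrbitalMeasureFamily.ofLocal L N H mG mGi c = quotientMeasure (Subgroup.centralizer ({((cmDatum L N H).toAdelic (Quotient.out c))} : Set (cmDatum L N H).Adelic)) tA (isClosed_coe_centralizer_singleton _) νA := by
  classical
  -- §0 ambient instances
  haveI : Countable (HeightOneSpectrum (𝓞 ↥(maximalRealSubfield L))) := countable_heightOneSpectrum ↥(maximalRealSubfield L)
  haveI : ∀ v, SecondCountableTopology ↥(localPi L (IsCMField.complexConj L) N H v) := fun v => secondCountableTopology_localPi L N (IsCMField.complexConj L) H v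
  haveI : ∀ v, LocallyCompactSpace ↥(localPi L (IsCMField.complexConj L) N H v) := fun v => locallyCompactSpace_localPi L N (IsCMField.complexConj L) H v
  haveI : LocallyCompactSpace (finAdelic (↥(maximalRealSubfield L)) L (IsCMField.complexConj L) N H) := locallyCompactSpace_finAdelic (↥(maximalRealSubfield L)) L (IsCMField.complexConj L) N H
  haveI : SecondCountableTopology (finAdelic (↥(maximalRealSubfield L)) L (IsCMField.complexConj L) N H) := secondCountableTopology_finAdelic (↥(maximalRealSubfield L)) L (IsCMField.complexConj L) N H
  haveI : T2Space (finAdelic (↥(maximalRealSubfield L)) L (IsCMField.complexConj L) N H) := t2Space_finAdelic (↥(maximalRealSubfield L)) L (IsCMField.complexConj L) N H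
  haveI : LocallyCompactSpace (cmDatum L N H).Adelic := locallyCompactSpace_cmDatum_Adelic L N H
  haveI : SecondCountableTopology (cmDatum L N H).Adelic := secondCountableTopology_cmDatum_Adelic L N H
  haveI : T2Space (cmDatum L N H).Adelic := t2Space_cmDatum_Adelic L N H
  haveI hKc : ∀ v, CompactSpace (localInt L (IsCMField.complexConj L) N H v) := fun v => isCompact_iff_compactSpace.1 (isCompact_localInt L (IsCMField.complexConj L) N H v)
  haveI : BorelSpace (Πʳ v : HeightOneSpectrum (𝓞 ↥(maximalRealSubfield L)), [↥(localPi L (IsCMField.complexConj L) N H v), localInt L (IsCMField.complexConj L) N H v]) :=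
    borelSpace (fun v => (localInt L (IsCMField.complexConj L) N H v : Set ↥(localPi L (IsCMField.complexConj L) N H v))) fun v => (isOpen_localInt L (IsCMField.complexConj L) N H v).measurableSet
  haveI : SecondCountableTopology (Πʳ v : HeightOneSpectrum (𝓞 ↥(maximalRealSubfield L)), [↥(localPi L (IsCMField.complexConj L) N H v), localInt L (IsCMField.complexConj L) N H v]) :=
    secondCountableTopology (fun v => (localInt L (IsCMField.complexConj L) N H v : Set ↥(localPi L (IsCMField.complexConj L) N H v))) fun v => isOpen_localInt L (IsCMField.complexConj L) N H v
  haveI hCP : ∀ v, IsClosed (((Subgroup.centralizer ({(finAdelicEquiv (↥(maximalRealSubfield L)) L (IsCMField.complexConj L) N H) (finPart (↥(maximalRealSubfield L)) L (IsCMField.complexConj L) N H ((cmDatum L N H).toAdelic (Quotient.out c))) v} : Set ↥(localPi L (IsCMField.complexConj L) N H v)))) : Set ↥(localPi L (IsCMField.complexConj L) N H v)) := fun v => isClosed_coe_centralizer_singleton _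
  haveI hCL : ∀ v, IsClosed (((Subgroup.centralizer ({((cmDatum L N H).toLocal v ((cmDatum L N H).toAdelic (Quotient.out c)))} : Set ((cmDatum L N H).Local v)))) : Set ((cmDatum L N H).Local v)) := fun v => isClosed_coe_centralizer_singleton _
  haveI hCi : IsClosed (((Subgroup.centralizer ({archPart (↥(maximalRealSubfield L)) L (IsCMField.complexConj L) N H ((cmDatum L N H).toAdelic (Quotient.out c))} : Set (arch (↥(maximalRealSubfield L)) L (IsCMField.complexConj L) N H)))) : Set (arch (↥(maximalRealSubfield L)) L (IsCMField.complexConj L) N H)) := isClosed_coe_centralizer_singleton _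
  haveI hCf : IsClosed (((Subgroup.centralizer ({(finPart (↥(maximalRealSubfield L)) L (IsCMField.complexConj L) N H ((cmDatum L N H).toAdelic (Quotient.out c)))} : Set (finAdelic (↥(maximalRealSubfield L)) L (IsCMField.complexConj L) N H)))) : Set (finAdelic (↥(maximalRealSubfield L)) L (IsCMField.complexConj L) N H)) := isClosed_coe_centralizer_singleton _
  have hCA : IsClosed (((Subgroup.centralizer ({((cmDatum L N H).toAdelic (Quotient.out c))} : Set (cmDatum L N H).Adelic))) : Set (cmDatum L N H).Adelic) := isClosed_coe_centralizer_singleton _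
  -- Borel σ-algebras on the model quotients (the (b3) convention; `ofLocal` uses `borel` on the finite-adelic one)
  letI : ∀ v, MeasurableSpace (↥(localPi L (IsCMField.complexConj L) N H v) ⧸ (Subgroup.centralizer ({(finAdelicEquiv (↥(maximalRealSubfield L)) L (IsCMField.complexConj L) N H) (finPart (↥(maximalRealSubfield L)) L (IsCMField.complexConj L) N H ((cmDatum L N H).toAdelic (Quotient.out c))) v} : Set ↥(localPi L (IsCMField.complexConj L) N H v)))) := fun v => borel _
  haveI : ∀ v, BorelSpace (↥(localPi L (IsCMField.complexConj L) N H v) ⧸ (Subgroup.centralizer ({(finAdelicEquiv (↥(maximalRealSubfield L)) L (IsCMField.complexConj L) N H) (finPart (↥(maximalRealSubfield L)) L (IsCMField.complexConj L) N H ((cmDatum L N H).toAdelic (Quotient.out c))) v} : Set ↥(localPi L (IsCMField.complexConj L) N H v)))) := fun v => ⟨rfl⟩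
  letI : MeasurableSpace ((Πʳ v : HeightOneSpectrum (𝓞 ↥(maximalRealSubfield L)), [↥(localPi L (IsCMField.complexConj L) N H v), localInt L (IsCMField.complexConj L) N H v]) ⧸ (Subgroup.centralizer ({(finAdelicEquiv (↥(maximalRealSubfield L)) L (IsCMField.complexConj L) N H) (finPart (↥(maximalRealSubfield L)) L (IsCMField.complexConj L) N H ((cmDatum L N H).toAdelic (Quotient.out c)))} : Set (Πʳ v : HeightOneSpectrum (𝓞 ↥(maximalRealSubfield L)), [↥(localPi L (IsCMField.complexConj L) N H v), localInt L (IsCMField.complexConj L) N H v])))) := borel _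
  haveI : BorelSpace ((Πʳ v : HeightOneSpectrum (𝓞 ↥(maximalRealSubfield L)), [↥(localPi L (IsCMField.complexConj L) N H v), localInt L (IsCMField.complexConj L) N H v]) ⧸ (Subgroup.centralizer ({(finAdelicEquiv (↥(maximalRealSubfield L)) L (IsCMField.complexConj L) N H) (finPart (↥(maximalRealSubfield L)) L (IsCMField.complexConj L) N H ((cmDatum L N H).toAdelic (Quotient.out c)))} : Set (Πʳ v : HeightOneSpectrum (𝓞 ↥(maximalRealSubfield L)), [↥(localPi L (IsCMField.complexConj L) N H v), localInt L (IsCMField.complexConj L) N H v])))) := ⟨rfl⟩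
  letI : MeasurableSpace ((Πʳ v : HeightOneSpectrum (𝓞 ↥(maximalRealSubfield L)), [↥(localPi L (IsCMField.complexConj L) N H v), localInt L (IsCMField.complexConj L) N H v]) ⧸ (cutout (fun v => localInt L (IsCMField.complexConj L) N H v) (fun v => (Subgroup.centralizer ({(finAdelicEquiv (↥(maximalRealSubfield L)) L (IsCMField.complexConj L) N H) (finPart (↥(maximalRealSubfield L)) L (IsCMField.complexConj L) N H ((cmDatum L N H).toAdelic (Quotient.out c))) v} : Set ↥(localPi L (IsCMField.complexConj L) N H v)))))) := borel _
  haveI : BorelSpace ((Πʳ v : HeightOneSpectrum (𝓞 ↥(maximalRealSubfield L)), [↥(localPi L (IsCMField.complexConj L) N H v), localInt L (IsCMField.complexConj L) N H v]) ⧸ (cutout (fun v => localInt L (IsCMField.complexConj L) N H v) (fun v => (Subgroup.centralizer ({(finAdelicEquiv (↥(maximalRealSubfield L)) L (IsCMField.complexConj L) N H) (finPart (↥(maximalRealSubfield L)) L (IsCMField.complexConj L) N H ((cmDatum L N H).toAdelic (Quotient.out c))) v} : Set ↥(localPi L (IsCMField.complexConj L) N H v)))))) := ⟨rfl⟩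
  letI : MeasurableSpace ((finAdelic (↥(maximalRealSubfield L)) L (IsCMField.complexConj L) N H) ⧸ (Subgroup.centralizer ({(finPart (↥(maximalRealSubfield L)) L (IsCMField.complexConj L) N H ((cmDatum L N H).toAdelic (Quotient.out c)))} : Set (finAdelic (↥(maximalRealSubfield L)) L (IsCMField.complexConj L) N H)))) := borel _
  haveI : BorelSpace ((finAdelic (↥(maximalRealSubfield L)) L (IsCMField.complexConj L) N H) ⧸ (Subgroup.centralizer ({(finPart (↥(maximalRealSubfield L)) L (IsCMField.complexConj L) N H ((cmDatum L N H).toAdelic (Quotient.out c)))} : Set (finAdelic (↥(maximalRealSubfield L)) L (IsCMField.complexConj L) N H)))) := ⟨rfl⟩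
  -- §1 the local torus measures of the canonical family at the regular points `g_v`
  have hregv : ∀ v, IsRegularElt ((((cmDatum L N H).toLocal v ((cmDatum L N H).toAdelic (Quotient.out c)))).val : GL (Fin N) (LocalRing L v)) :=
    fun v => isRegularElt_toLocal_toAdelic L H (Quotient.out c) hreg v
  have hloc : ∀ v, ∃ tv : Measure (Subgroup.centralizer ({((cmDatum L N H).toLocal v ((cmDatum L N H).toAdelic (Quotient.out c)))} : Set ((cmDatum L N H).Local v))), ∃ (_ : tv.IsHaarMeasure) (_ : tv.IsInvInvariant),
      tv (compactCore (Subgroup.centralizer ({((cmDatum L N H).toLocal v ((cmDatum L N H).toAdelic (Quotient.out c)))} : Set ((cmDatum L N H).Local v)))) = 1 ∧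
        (mG v).atPoint ((cmDatum L N H).toLocal v ((cmDatum L N H).toAdelic (Quotient.out c))) = quotientMeasure (Subgroup.centralizer ({((cmDatum L N H).toLocal v ((cmDatum L N H).toAdelic (Quotient.out c)))} : Set ((cmDatum L N H).Local v))) tv (isClosed_coe_centralizer_singleton _) (ν v) :=
    fun v => exists_torusMeasure_atPoint_eq L N H v ((cmDatum L N H).toAdelic (Quotient.out c)) (hcan v) (hregv v)
  choose t htH htI ht1c hat using hloc
  haveI : ∀ v, LocallyCompactSpace (Subgroup.centralizer ({((cmDatum L N H).toLocal v ((cmDatum L N H).toAdelic (Quotient.out c)))} : Set ((cmDatum L N H).Local v))) := fun v => (hCL v).isClosedEmbedding_subtypeVal.locallyCompactSpace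
  haveI : ∀ v, SigmaFinite (t v) := fun v => sigmaFinite_of_isHaarMeasure_of_isClosed _ (hCL v) (t v)
  haveI : ∀ v, SFinite (t v) := fun v => inferInstance
  -- §2 the exceptional set: the compact core of `C(g_v)` lies in `U(H)(𝒪_v)` off `S₀`
  obtain ⟨S₀, hS₀⟩ := exists_finset_compactCore_centralizer_subset_of_hermitian L N H hH hHd (Quotient.out c) hreg
  have hnorm : IsNormalisedOff L N H mG ((cmDatum L N H).toAdelic (Quotient.out c)) S₀ := by
    intro v hv
    rw [hat v]
    exact quotientMeasure_image_mk_eq_one_of_compactCore_subset _ (t v) (ν v) (cmLocalIntegralLevel L N H v)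
      (isCompact_isOpen_cmLocalIntegralLevel L N H v).2 (isCompact_isOpen_cmLocalIntegralLevel L N H v).1 (hK v) (ht1c v) (hS₀ v hv)
  -- §3 the model-side data of ★ `UnitaryGroupLocalTorusPackage`
  haveI hν'H : ∀ v, IsHaarMeasure (Measure.map (ψ v).symm (ν v)) := fun v => isHaarMeasure_map_localModel_symm v (ψ v) (ν v)
  haveI hν'R : ∀ v, (Measure.map (ψ v).symm (ν v)).IsMulRightInvariant := fun v => isMulRightInvariant_map_localPiEquiv_symm L N H v (ψ v) (ν v)
  haveI ht'H : ∀ v, IsHaarMeasure (Measure.map (subgroupCongrHomeomorph (ψ v).symm.toMulEquiv (Subgroup.centralizer ({((cmDatum L N H).toLocal v ((cmDatum L N H).toAdelic (Quotient.out c)))} : Set ((cmDatum L N H).Local v))) (Subgroup.centralizer ({(finAdelicEquiv (↥(maximalRealSubfield L)) L (IsCMField.complexConj L) N H) (finPart (↥(maximalRealSubfield L)) L (IsCMField.complexConj L) N H ((cmDatum L N H).toAdelic (Quotient.out c))) v} : Set ↥(localPi L (IsCMField.complexConj L) N H v))) (localPiEquiv_symm_mem_centralizer_iff L N H v ((cmDatum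 L N H).toAdelic (Quotient.out c)) (ψ v) (congrFun hψ v)) (ψ v).symm.continuous (ψ v).continuous) (t v)) := fun v => isHaarMeasure_torusTransport L N H v ((cmDatum L N H).toAdelic (Quotient.out c)) (ψ v) (congrFun hψ v) (t v)
  haveI ht'I : ∀ v, (Measure.map (subgroupCongrHomeomorph (ψ v).symm.toMulEquiv (Subgroup.centralizer ({((cmDatum L N H).toLocal v ((cmDatum L N H).toAdelic (Quotient.out c)))} : Set ((cmDatum L N H).Local v))) (Subgroup.centralizer ({(finAdelicEquiv (↥(maximalRealSubfield L)) L (IsCMField.complexConj L) N H) (finPart (↥(maximalRealSubfield L)) L (IsCMField.complexConj L) N H ((cmDatum L N H).toAdelic (Quotient.out c))) v} : Set ↥(localPi L (IsCMField.complexConj L) N H v))) (localPiEquiv_symm_mem_centralizer_iff L N H v ((cmDatum L N H).toAdelic (Quotient.out c)) (ψ v) (congrFun hψ v)) (ψ v).symm.continuous (ψ v).continuous) (t v)).IsInvInvariant := fun v => isInvInvariant_torusTransport L N H v ((cmDatum L N H).toAdelic (Quotient.out c)) (ψ v) (congrFun hψ v) (t v)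
  haveI : ∀ v, LocallyCompactSpace (Subgroup.centralizer ({(finAdelicEquiv (↥(maximalRealSubfield L)) L (IsCMField.complexConj L) N H) (finPart (↥(maximalRealSubfield L)) L (IsCMField.complexConj L) N H ((cmDatum L N H).toAdelic (Quotient.out c))) v} : Set ↥(localPi L (IsCMField.complexConj L) N H v))) := fun v => (hCP v).isClosedEmbedding_subtypeVal.locallyCompactSpace
  haveI ht'S : ∀ v, SigmaFinite (Measure.map (subgroupCongrHomeomorph (ψ v).symm.toMulEquiv (Subgroup.centralizer ({((cmDatum L N H).toLocal v ((cmDatum L N H).toAdelic (Quotient.out c)))} : Set ((cmDatum L N H).Local v))) (Subgroup.centralizer ({(finAdelicEquiv (↥(maximalRealSubfield L)) L (IsCMField.complexConj L) N H) (finPart (↥(maximalRealSubfield L)) L (IsCMField.complexConj L) N H ((cmDatum L N H).toAdelic (Quotient.out c))) v} : Set ↥(localPi L (IsCMField.complexConj L) N H v))) (localPiEquiv_symm_mem_centralizer_iff L N H v ((cmDatum L N H).toAdelic (Quotient.out c)) (ψ v) (congrFun hψ v)) (ψ v).symm.continuous (ψ v).continuous) (t v)) := fun v => sigmaFinite_of_isHaarMeasure_of_isClosed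 _ (hCP v) _
  haveI : ∀ v, SFinite (Measure.map (subgroupCongrHomeomorph (ψ v).symm.toMulEquiv (Subgroup.centralizer ({((cmDatum L N H).toLocal v ((cmDatum L N H).toAdelic (Quotient.out c)))} : Set ((cmDatum L N H).Local v))) (Subgroup.centralizer ({(finAdelicEquiv (↥(maximalRealSubfield L)) L (IsCMField.complexConj L) N H) (finPart (↥(maximalRealSubfield L)) L (IsCMField.complexConj L) N H ((cmDatum L N H).toAdelic (Quotient.out c))) v} : Set ↥(localPi L (IsCMField.complexConj L) N H v))) (localPiEquiv_symm_mem_centralizer_iff L N H v ((cmDatum L N H).toAdelic (Quotient.out c)) (ψ v) (congrFun hψ v)) (ψ v).symm.continuous (ψ v).continuous) (t v)) := fun v => inferInstance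
  have hm : ∀ v, Measure.map (cosetCongr (ψ v).symm.toMulEquiv (Subgroup.centralizer ({((cmDatum L N H).toLocal v ((cmDatum L N H).toAdelic (Quotient.out c)))} : Set ((cmDatum L N H).Local v))) (Subgroup.centralizer ({(finAdelicEquiv (↥(maximalRealSubfield L)) L (IsCMField.complexConj L) N H) (finPart (↥(maximalRealSubfield L)) L (IsCMField.complexConj L) N H ((cmDatum L N H).toAdelic (Quotient.out c))) v} : Set ↥(localPi L (IsCMField.complexConj L) N H v))) (localPiEquiv_symm_mem_centralizer_iff L N H v ((cmDatum L N H).toAdelic (Quotient.out c)) (ψ v) (congrFun hψ v)))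
      (quotientMeasure (Subgroup.centralizer ({((cmDatum L N H).toLocal v ((cmDatum L N H).toAdelic (Quotient.out c)))} : Set ((cmDatum L N H).Local v))) (t v) (hCL v) (ν v)) = quotientMeasure (Subgroup.centralizer ({(finAdelicEquiv (↥(maximalRealSubfield L)) L (IsCMField.complexConj L) N H) (finPart (↥(maximalRealSubfield L)) L (IsCMField.complexConj L) N H ((cmDatum L N H).toAdelic (Quotient.out c))) v} : Set ↥(localPi L (IsCMField.complexConj L) N H v))) (Measure.map (subgroupCongrHomeomorph (ψ v).symm.toMulEquiv (Subgroup.centralizer ({((cmDatum L N H).toLocal v ((cmDatum L N H).toAdelic (Quotient.out c)))} : Set ((cmDatum L N H).Local v))) (Subgroup.centralizer ({(finAdelicEquiv (↥(maximalRealSubfield L)) L (IsCMField.complexConj L) N H) (finPart (↥(maximalRealSubfield L)) L (IsCMField.complexConj L) N H ((cmDatum L N H).toAdelic (Quotient.out c))) v} : Set ↥(localPi L (IsCMField.complexConj L) N H v))) (localPiEquiv_symm_mem_centralizer_iff L N H v ((cmDatum L N H).toAdelic (Quotient.out c)) (ψ v) (congrFun hψ v)) (ψ v).symm.continuous (ψ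 v).continuous) (t v)) (hCP v) (Measure.map (ψ v).symm (ν v)) :=
    fun v => map_cosetCongr_quotientMeasure_torusTransport L N H v ((cmDatum L N H).toAdelic (Quotient.out c)) (ψ v) (congrFun hψ v) (ν v) _ rfl (t v) _ rfl
  have hν1 : ∀ v, v ∉ S₀ → (Measure.map (ψ v).symm (ν v)) (localInt L (IsCMField.complexConj L) N H v : Set ↥(localPi L (IsCMField.complexConj L) N H v)) = 1 :=
    fun v _ => map_localPiEquiv_symm_apply_localInt_eq_one v (ψ v) (congrFun hψ v) (ν v) (hK v)
  have ht1 : ∀ v, v ∉ S₀ → (Measure.map (subgroupCongrHomeomorph (ψ v).symm.toMulEquiv (Subgroup.centralizer ({((cmDatum L N H).toLocal v ((cmDatum L N H).toAdelic (Quotient.out c)))} : Set ((cmDatum L N H).Local v))) (Subgroup.centralizer ({(finAdelicEquiv (↥(maximalRealSubfield L)) L (IsCMField.complexConj L) N H) (finPart (↥(maximalRealSubfield L)) L (IsCMField.complexConj L) N H ((cmDatum L N H).toAdelic (Quotient.out c))) v} : Set ↥(localPi L (IsCMField.complexConj L) N H v))) (localPiEquiv_symm_mem_centralizer_iff L N H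 v ((cmDatum L N H).toAdelic (Quotient.out c)) (ψ v) (congrFun hψ v)) (ψ v).symm.continuous (ψ v).continuous) (t v)) ((((inH (fun v => localInt L (IsCMField.complexConj L) N H v) (fun v => (Subgroup.centralizer ({(finAdelicEquiv (↥(maximalRealSubfield L)) L (IsCMField.complexConj L) N H) (finPart (↥(maximalRealSubfield L)) L (IsCMField.complexConj L) N H ((cmDatum L N H).toAdelic (Quotient.out c))) v} : Set ↥(localPi L (IsCMField.complexConj L) N H v)))) v) : Subgroup (Subgroup.centralizer ({(finAdelicEquiv (↥(maximalRealSubfield L)) L (IsCMField.complexConj L) N H) (finPart (↥(maximalRealSubfield L)) L (IsCMField.complexConj L) N H ((cmDatum L N H).toAdelic (Quotient.out c))) v} : Set ↥(localPi L (IsCMField.complexConj L) N H v)))) : Set (Subgroup.centralizer ({(finAdelicEquiv (↥(maximalRealSubfield L)) L (IsCMField.complexConj L) N H) (finPart (↥(maximalRealSubfield L)) L (IsCMField.complexConj L) N H ((cmDatum L N H).toAdelic (Quotient.out c))) v} : Set ↥(localPi L (IsCMField.complexConj L) N H v))))) = 1 :=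
    fun v hv => torusTransport_apply_inH_eq_one L N H v ((cmDatum L N H).toAdelic (Quotient.out c)) (ψ v) (congrFun hψ v) (t v) (ht1c v) (hS₀ v hv) _ rfl
  have hm1 : ∀ v, v ∉ S₀ → quotientMeasure (Subgroup.centralizer ({(finAdelicEquiv (↥(maximalRealSubfield L)) L (IsCMField.complexConj L) N H) (finPart (↥(maximalRealSubfield L)) L (IsCMField.complexConj L) N H ((cmDatum L N H).toAdelic (Quotient.out c))) v} : Set ↥(localPi L (IsCMField.complexConj L) N H v))) (Measure.map (subgroupCongrHomeomorph (ψ v).symm.toMulEquiv (Subgroup.centralizer ({((cmDatum L N H).toLocal v ((cmDatum L N H).toAdelic (Quotient.out c)))} : Set ((cmDatum L N H).Local v))) (Subgroup.centralizer ({(finAdelicEquiv (↥(maximalRealSubfield L)) L (IsCMField.complexConj L) N H) (finPart (↥(maximalRealSubfield L)) L (IsCMField.complexConj L) N H ((cmDatum L N H).toAdelic (Quotient.out c))) v} : Set ↥(localPi L (IsCMField.complexConj L) N H v))) (localPiEquiv_symm_mem_centralizer_iff L N H v ((cmDatum L N H).toAdelic (Quotient.out c)) (ψ v) (congrFun hψ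 v)) (ψ v).symm.continuous (ψ v).continuous) (t v)) (hCP v) (Measure.map (ψ v).symm (ν v)) (quotBase (fun v => localInt L (IsCMField.complexConj L) N H v) (fun v => (Subgroup.centralizer ({(finAdelicEquiv (↥(maximalRealSubfield L)) L (IsCMField.complexConj L) N H) (finPart (↥(maximalRealSubfield L)) L (IsCMField.complexConj L) N H ((cmDatum L N H).toAdelic (Quotient.out c))) v} : Set ↥(localPi L (IsCMField.complexConj L) N H v)))) v) = 1 :=
    fun v hv => quotientMeasure_torusTransport_quotBase_eq_one L N H v ((cmDatum L N H).toAdelic (Quotient.out c)) (ψ v) (congrFun hψ v) (ν v) (hK v) _ rfl (t v) (ht1c v) (hS₀ v hv) _ rfl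
  -- §4 the archimedean Haar measure matching `ν_𝔸` (★ C-glob) and the archimedean torus measure (`harch`)
  obtain ⟨νi, hνiH, hνA⟩ := exists_isHaarMeasure_arch_eq_map_prod_rpMeasure (fun v => (Measure.map (ψ v).symm (ν v))) S₀ hν1 νA e he'
  haveI := hνiH
  haveI hνiR : νi.IsMulRightInvariant := isMulRightInvariant_of_modularCharacterFun_eq_one (modularCharacterFun_arch_eq_one L H hH hHd) νi
  obtain ⟨ti, htiH, htiI, hti⟩ := harch νi
  haveI := htiH
  haveI := htiI
  -- §5 the tower (★ `exists_tower_adelicOrbitalMeasureOfLocal_eq_quotientMeasure`)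
  obtain ⟨νrp, ρ, ρM, νf, tf, tP, tA, νA', i1, i2, i3, i4, i5, i6, i7, i8, i9, i10, i11, i12, i13, i14, i15, i16, i17, i18, i19, i20, i21, i22,
      hνrp, hρ, hρM, hνf, htf, htP, htA, hνA', hid⟩ :=
    exists_tower_adelicOrbitalMeasureOfLocal_eq_quotientMeasure L N H ((cmDatum L N H).toAdelic (Quotient.out c)) ν t S₀ (hCi := hCi) (hCf := hCf) hanis ⟨Quotient.out c, rfl⟩ hCA ψ hψ
      (fun v => (localPiEquiv_symm_mem_centralizer_iff L N H v ((cmDatum L N H).toAdelic (Quotient.out c)) (ψ v) (congrFun hψ v))) hCrp νi ti (fun v => (Measure.map (ψ v).symm (ν v))) (fun v => (Measure.map (subgroupCongrHomeomorph (ψ v).symm.toMulEquiv (Subgroup.centralizer ({((cmDatum L N H).toLocal v ((cmDatum L N H).toAdelic (Quotient.out c)))} : Set ((cmDatum L N H).Local v))) (Subgroup.centralizer ({(finAdelicEquiv (↥(maximalRealSubfield L)) L (IsCMField.complexConj L) N H) (finPart (↥(maximalRealSubfield L)) L (IsCMField.complexConj L) N H ((cmDatum L N H).toAdelic (Quotient.out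 c))) v} : Set ↥(localPi L (IsCMField.complexConj L) N H v))) (localPiEquiv_symm_mem_centralizer_iff L N H v ((cmDatum L N H).toAdelic (Quotient.out c)) (ψ v) (congrFun hψ v)) (ψ v).symm.continuous (ψ v).continuous) (t v))) hm hν1 ht1 hm1 e he' he hes hg
  have hAA : νA' = νA := by rw [hνA', hνf, hνrp, ← hνA]
  subst hAA
  -- §6 `ofLocal` is the construction, with the local and archimedean members rewritten as quotient measures
  have hadm : ∀ v, mG v (ConjClasses.mk ((cmDatum L N H).toLocal v ((cmDatum L N H).toAdelic (Quotient.out c)))) ≠ 0 ∧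
      SMulInvariantMeasure ((cmDatum L N H).Local v) _ (mG v (ConjClasses.mk ((cmDatum L N H).toLocal v ((cmDatum L N H).toAdelic (Quotient.out c))))) ∧
      IsFiniteMeasureOnCompacts (mG v (ConjClasses.mk ((cmDatum L N H).toLocal v ((cmDatum L N H).toAdelic (Quotient.out c))))) :=
    fun v => (hcan v).isAdmissibleOn.at_mk _ (isRegularElt_out_mk_local (hregv v))
  have hofl := AdelicOrbitalMeasureFamily.ofLocal_eq L N H mG mGi c hnorm hadm
  have hfun : (fun v => (mG v).atPoint ((cmDatum L N H).toLocal v ((cmDatum L N H).toAdelic (Quotient.out c)))) = fun v => quotientMeasure (Subgroup.centralizer ({((cmDatum L N H).toLocal v ((cmDatum L N H).toAdelic (Quotient.out c)))} : Set ((cmDatum L N H).Local v))) (t v) (hCL v) (ν v) :=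
    funext fun v => hat v
  rw [hfun, hti] at hofl
  refine ⟨S₀, t, νi, ti, νrp, ρ, ρM, νf, tf, tP, tA, htH, htI, hνiH, hνiR, htiH, htiI, i1, i2, i3, i4, i5, i6, i7, i8, i9, i10, i11, i12, i13, i14,
    i15, i16, i17, i18, i19, i20, i22, ht1c, hat, hti, hnorm, ht1, hνrp, hρ, hρM, hνf, htf, htP, htA, hνA', ?_⟩
  rw [hofl]
  exact hid

end Kit

end UnitaryGroup

end Literature.NumberTheory.Automorphic
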